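import Summits.CriticalPhenomena.Ising3DConformalLimit.Theorems.IsingEuclidUpgradeIsingEuclidUpgradeR2RotInvPowerLawVagueToRays
import Summits.CriticalPhenomena.Ising3DConformalLimit.Theorems.IsingEuclidUpgradeIsingEuclidUpgradeR2RotInvPowerLawKaramataLink
import Summits.CriticalPhenomena.Ising3DConformalLimit.Theorems.PrecisionLaplacianDirectCorrelationStableTailExponentWindow
import Literature.Probability.LatticeModels.IsingExponents
import HarnessLib

/-!
# Crux `IsingEuclidUpgradeR2RotInvPowerLaw` (stmt-CriticalPhenomena-0634), line `tower_profile_rigidity`: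
# CONVERSES — r2 ⇒ `EtaBoundsExist` (item 4662), r2 ⇒ `TwoPointRegularVariation` (item 5047),
# and the lossless iff r2 ⟺ T1 ∧ 5047 ∧ 6036

Write `G := criticalTwoPoint 3` for the critical two-point function `⟨σ₀σ_x⟩_{β_c}` of the
nearest-neighbour Ising model on `ℤ³`, `g(n) := G(n e₀)` for its axis sequence (`g > 0`,
`criticalTwoPoint_axis_pos`), `‖x‖` for the sup norm and `|x|₂ := √(∑ xᵢ²)` for the Euclidean norm
of `x ∈ ℤ³` (`‖x‖ ≤ |x|₂ ≤ √3 ‖x‖`). The crux r2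
(`Theses.IsingEuclidUpgrade.IsingEuclidUpgradeR2RotInvPowerLaw`, item stmt-CriticalPhenomena-0634) reads
`∃ Δ, ∃ c > 0, G(x) |x|₂^{2Δ} → c` along the cofinite filter of `ℤ³`; the tree theorem
`twoPointLaw_exponent_mem_Icc` gives `1/2 ≤ Δ ≤ 1` for any such `Δ`.

**Theorems** (registered names of the line, statements verbatim).

* `etaBoundsExist_of_rotInvPowerLaw` : **r2 ⇒ item stmt-CriticalPhenomena-4662**
  (`Theses.HelsonAxis.EtaBoundsExist = ∃ η, HasIsingEtaBounds 3 η`, two-sided pure-power bounds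
  `c'‖x‖^{-(1+η)} ≤ G(x) ≤ C'‖x‖^{-(1+η)}`), with `η := 2Δ - 1`. Proof: off a finite set
  `c/2 < G(x)|x|₂^{2Δ} < 2c`, and `‖x‖ ≤ |x|₂ ≤ √3‖x‖` with `2Δ ≥ 0` converts `|x|₂^{-2Δ}` into
  `‖x‖^{-2Δ}` up to the constants `1` and `(√3)^{-2Δ}`; on the finite exceptional set (norms `< R₀`)
  the tree bounds `c₁‖x‖^{-2} ≤ G(x) ≤ 1` and `1 ≤ ‖x‖ < R₀` absorb the constants. Both steps are
  the landed lemmas `expWin_scaleBounds_of_tendsto` / `expWin_isPowerBounded` of the file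
  `…PrecisionLaplacianDirectCorrelationStableTailExponentWindow` (route PrecisionLaplacian), reused.
* `twoPointRegularVariation_of_rotInvPowerLaw` : **r2 ⇒ item stmt-CriticalPhenomena-5047**
  (`Theses.BallOrbitComparison.TwoPointRegularVariation`: `ρ_c(cδ)/ρ_c(δ) → c^{-Δ}` at `0⁺` for every
  `c > 0`, some `Δ > 0`, where `ρ_c(δ) = g(⌊δ⁻¹⌋)^{-1/2}`). Proof: r2 ⇒ D1 (`g(n)n^{2Δ} → c₀`,
  `axis_tendsto_of_tendsto`) and `Δ > 0` (`twoPointLaw_exponent_pos`); with `n_δ := ⌊δ⁻¹⌋ → ∞`,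
  `m_δ := ⌊(cδ)⁻¹⌋ → ∞` and `m_δ/n_δ → c⁻¹` as `δ → 0⁺`,
  `ρ_c(cδ)/ρ_c(δ) = √(g(n_δ)/g(m_δ)) = √( [g(n_δ)n_δ^{2Δ}] / [g(m_δ)m_δ^{2Δ}] · (m_δ/n_δ)^{2Δ} )
   → √(1 · c^{-2Δ}) = c^{-Δ}`.
* `rotInvPowerLaw_iff_towerLaw_and_twoPointRegularVariation_and_vague` : **r2 ⟺ T1 ∧ 5047 ∧ 6036**
  (T1 the dyadic tower law, 6036 = `Theses.HarmonicMomentsIsotropy.TwoPointAsymptoticIsotropy`):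
  ⇒ by `towerLaw_of_rotInvPowerLaw`, the theorem above and `twoPointAsymptoticIsotropy_of_rotInvPowerLaw`;
  ⇐ by `integerDilationLaw_of_twoPointRegularVariation` (5047 ⇒ S2, the Karamata link) and the glue
  `IsingEuclidUpgradeR2RotInvPowerLaw_of_towerLaw_of_dilationLaw_of_vague` (T1 → S2 → 6036 → r2).
  So the two upstream links `4662` and `5047` of the line are LOSSLESS consequences of the crux.

References: H. Duminil-Copin, ICM 2022, §8.1 (the pure power law / rotation invariance of the
critical two-point function on `ℤ³` and the existence of `η` are open; nothing unconditional about
them is claimed here) [DuminilCopinICM2022]; the manipulations are folklore. No definitions are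
introduced.
-/

noncomputable section

namespace Summit.CriticalPhenomena.Ising3DConformalLimit.Cruxes.IsingEuclidUpgradeR2RotInvPowerLaw.TowerProfileRigidity

open Filter Topology Literature.Probability.LatticeModels
open Summit.CriticalPhenomena.Ising3DConformalLimit.Theorems.IsingEuclidUpgradeR2Split (axis_tendsto_of_tendsto)
open Summit.CriticalPhenomena.Ising3DConformalLimit.Cruxes.DirectCorrelationStableTail.DiffusiveBranchIsNonsaturation
  (expWin_scaleBounds_of_tendsto expWin_isPowerBounded)
open Summit.CriticalPhenomena.Ising3DConformalLimit.HarmonicMomentsIsotropyTwoPoint (twoPointAsymptoticIsotropy_of_rotInvPowerLaw)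

/-! ### r2 ⇒ item 4662 (`EtaBoundsExist`) -/

/-- **r2 ⇒ `EtaBoundsExist` (registered name, verbatim).** The rotation-invariant pure power law
`G(x)|x|₂^{2Δ} → c > 0` (item stmt-CriticalPhenomena-0634) implies the two-sided pure-power bounds of
item stmt-CriticalPhenomena-4662, `HasIsingEtaBounds 3 η` with `η = 2Δ - 1` (`2Δ ≥ 1` by
`twoPointLaw_exponent_mem_Icc`): off a finite set `c/2 < G(x)|x|₂^{2Δ} < 2c` and
`‖x‖ ≤ |x|₂ ≤ √3‖x‖` (`expWin_scaleBounds_of_tendsto`, with `G ≤ 1`); on the finite exceptional set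
the tree bound `c₁‖x‖^{-2} ≤ G` and `1 ≤ ‖x‖ < R₀` suffice (`expWin_isPowerBounded`).
[cite: DuminilCopinICM2022, §8.1] -/
theorem etaBoundsExist_of_rotInvPowerLaw : Summit.CriticalPhenomena.Ising3DConformalLimit.Theses.IsingEuclidUpgrade.IsingEuclidUpgradeR2RotInvPowerLaw → Summit.CriticalPhenomena.Ising3DConformalLimit.Theses.HelsonAxis.EtaBoundsExist := by
  rintro ⟨Δ, c, hc, hT⟩
  obtain ⟨hΔlo, -⟩ := twoPointLaw_exponent_mem_Icc hc hT
  -- sup-norm scale bounds with exponent `2Δ ≥ 0`: upper for all `x ≠ 0`, lower for `‖x‖ ≥ R₀`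
  obtain ⟨c₁, C₁, R₀, hc₁, hR₀1, hup, hlo⟩ :=
    expWin_scaleBounds_of_tendsto (G := criticalTwoPoint 3) (κ := 2 * Δ) (by linarith) hc
      criticalTwoPoint_le_one' hT
  refine ⟨2 * Δ - 1, ?_⟩
  show IsPowerBounded (criticalTwoPoint 3) (((3 : ℕ) : ℝ) - 2 + (2 * Δ - 1))
  rw [show ((3 : ℕ) : ℝ) - 2 + (2 * Δ - 1) = 2 * Δ by push_cast; ring]
  -- the finitely many `0 < ‖x‖ < R₀` are absorbed by the tree lower bound `c'‖x‖⁻² ≤ G`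
  exact expWin_isPowerBounded (by linarith) hc₁ hR₀1 hup hlo

/-! ### r2 ⇒ item 5047 (`TwoPointRegularVariation`) -/

/-- `(cδ)⁻¹ → +∞` as `δ → 0⁺` (`c > 0`). [folklore] -/
theorem convTendsto_mul_inv_nhdsGT_zero {c : ℝ} (hc : 0 < c) :
    Tendsto (fun δ : ℝ => (c * δ)⁻¹) (𝓝[>] (0 : ℝ)) atTop := by
  refine (tendsto_inv_nhdsGT_zero.const_mul_atTop (inv_pos.2 hc)).congr fun δ => ?_
  rw [mul_inv]

/-- The ratio of floors `⌊(cδ)⁻¹⌋ / ⌊δ⁻¹⌋ → c⁻¹` as `δ → 0⁺` (`c > 0`): both floors are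
asymptotic to their arguments (`tendsto_nat_floor_div_atTop`). [folklore] -/
theorem convTendsto_floor_div_floor {c : ℝ} (hc : 0 < c) :
    Tendsto (fun δ : ℝ => ((⌊(c * δ)⁻¹⌋₊ : ℕ) : ℝ) / ((⌊δ⁻¹⌋₊ : ℕ) : ℝ)) (𝓝[>] (0 : ℝ))
      (𝓝 c⁻¹) := by
  have hinv : Tendsto (fun δ : ℝ => δ⁻¹) (𝓝[>] (0 : ℝ)) atTop := tendsto_inv_nhdsGT_zero
  have hcinv := convTendsto_mul_inv_nhdsGT_zero hc
  have h1 : Tendsto (fun δ : ℝ => ((⌊(c * δ)⁻¹⌋₊ : ℕ) : ℝ) / (c * δ)⁻¹) (𝓝[>] (0 : ℝ)) (𝓝 1) :=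
    (tendsto_nat_floor_div_atTop (R := ℝ)).comp hcinv
  have h2 : Tendsto (fun δ : ℝ => ((⌊δ⁻¹⌋₊ : ℕ) : ℝ) / δ⁻¹) (𝓝[>] (0 : ℝ)) (𝓝 1) :=
    (tendsto_nat_floor_div_atTop (R := ℝ)).comp hinv
  have h3 := (h1.mul_const c⁻¹).div h2 one_ne_zero
  rw [one_mul, div_one] at h3
  refine h3.congr' ?_
  filter_upwards [self_mem_nhdsWithin] with δ hδ
  have hδ0 : (0 : ℝ) < δ := hδ
  simp only [Pi.div_apply]
  generalize ((⌊(c * δ)⁻¹⌋₊ : ℕ) : ℝ) = a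
  generalize ((⌊δ⁻¹⌋₊ : ℕ) : ℝ) = b
  rw [div_inv_eq_mul, div_inv_eq_mul, mul_comm c δ, ← mul_assoc, mul_assoc _ c,
    mul_inv_cancel₀ hc.ne', mul_one, mul_div_mul_right _ _ hδ0.ne']

/-- **r2 ⇒ `TwoPointRegularVariation` (registered name, verbatim).** The rotation-invariant pure power
law (item stmt-CriticalPhenomena-0634) implies item stmt-CriticalPhenomena-5047: with the `Δ > 0` of the
power law (`twoPointLaw_exponent_pos`), `ρ_c(cδ)/ρ_c(δ) → c^{-Δ}` as `δ → 0⁺` for every `c > 0`, where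
`ρ_c(δ) = ⟨σ₀σ_{⌊δ⁻¹⌋e₀}⟩_{β_c(3)}^{-1/2}`. Through the axial law `g(n)n^{2Δ} → c₀`
(`axis_tendsto_of_tendsto`) read at `n_δ = ⌊δ⁻¹⌋` and `m_δ = ⌊(cδ)⁻¹⌋`, and `m_δ/n_δ → c⁻¹`:
`ρ_c(cδ)/ρ_c(δ) = √(g(n_δ)/g(m_δ)) → √(c^{-2Δ}) = c^{-Δ}`. [cite: DuminilCopinICM2022, §8.1] -/
theorem twoPointRegularVariation_of_rotInvPowerLaw : Summit.CriticalPhenomena.Ising3DConformalLimit.Theses.IsingEuclidUpgrade.IsingEuclidUpgradeR2RotInvPowerLaw → Summit.CriticalPhenomena.Ising3DConformalLimit.Theses.BallOrbitComparison.TwoPointRegularVariation := by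
  rintro ⟨Δ, c₀, hc₀, hT⟩
  have hΔ : 0 < Δ := twoPointLaw_exponent_pos hc₀ hT
  have haxis := axis_tendsto_of_tendsto hT
  show ∃ Δ : ℝ, 0 < Δ ∧ ∀ c : ℝ, 0 < c → Tendsto
    (fun δ : ℝ => 1 / Real.sqrt (criticalTwoPoint 3 (Pi.single 0 ⌊(c * δ)⁻¹⌋)) /
      (1 / Real.sqrt (criticalTwoPoint 3 (Pi.single 0 ⌊δ⁻¹⌋))))
    (𝓝[>] (0 : ℝ)) (𝓝 (c ^ (-Δ)))
  refine ⟨Δ, hΔ, fun c hc => ?_⟩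
  -- notation
  set g : ℕ → ℝ := fun n => criticalTwoPoint 3 (Pi.single 0 ((n : ℕ) : ℤ)) with hg
  have gpos : ∀ n, 0 < g n := fun n => criticalTwoPoint_axis_pos n
  set N : ℝ → ℕ := fun δ => ⌊δ⁻¹⌋₊ with hN
  set M : ℝ → ℕ := fun δ => ⌊(c * δ)⁻¹⌋₊ with hM
  have hinv : Tendsto (fun δ : ℝ => δ⁻¹) (𝓝[>] (0 : ℝ)) atTop := tendsto_inv_nhdsGT_zero
  have hNtop : Tendsto N (𝓝[>] (0 : ℝ)) atTop := tendsto_nat_floor_atTop.comp hinv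
  have hMtop : Tendsto M (𝓝[>] (0 : ℝ)) atTop :=
    tendsto_nat_floor_atTop.comp (convTendsto_mul_inv_nhdsGT_zero hc)
  -- the three convergent factors
  have hA : Tendsto (fun δ => g (N δ) * ((N δ : ℕ) : ℝ) ^ (2 * Δ)) (𝓝[>] (0 : ℝ)) (𝓝 c₀) :=
    haxis.comp hNtop
  have hB : Tendsto (fun δ => g (M δ) * ((M δ : ℕ) : ℝ) ^ (2 * Δ)) (𝓝[>] (0 : ℝ)) (𝓝 c₀) :=
    haxis.comp hMtop
  have hr : Tendsto (fun δ => (((M δ : ℕ) : ℝ) / ((N δ : ℕ) : ℝ)) ^ (2 * Δ)) (𝓝[>] (0 : ℝ))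
      (𝓝 ((c⁻¹) ^ (2 * Δ))) :=
    (convTendsto_floor_div_floor hc).rpow_const (Or.inl (inv_pos.2 hc).ne')
  have hlim : Tendsto (fun δ => Real.sqrt ((g (N δ) * ((N δ : ℕ) : ℝ) ^ (2 * Δ)) /
      (g (M δ) * ((M δ : ℕ) : ℝ) ^ (2 * Δ)) * (((M δ : ℕ) : ℝ) / ((N δ : ℕ) : ℝ)) ^ (2 * Δ)))
      (𝓝[>] (0 : ℝ)) (𝓝 (Real.sqrt (c₀ / c₀ * (c⁻¹) ^ (2 * Δ)))) :=
    ((hA.div hB hc₀.ne').mul hr).sqrt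
  have hval : Real.sqrt (c₀ / c₀ * (c⁻¹) ^ (2 * Δ)) = c ^ (-Δ) := by
    rw [div_self hc₀.ne', one_mul, show 2 * Δ = Δ * 2 by ring, Real.rpow_mul (inv_nonneg.2 hc.le),
      Real.rpow_two, Real.sqrt_sq (Real.rpow_nonneg (inv_nonneg.2 hc.le) _), Real.inv_rpow hc.le,
      Real.rpow_neg hc.le]
  rw [hval] at hlim
  -- eventually `δ > 0`, `n_δ ≥ 1`, `m_δ ≥ 1`, where the function under the root is `g(n_δ)/g(m_δ)`
  have hevN : ∀ᶠ δ in 𝓝[>] (0 : ℝ), 1 ≤ N δ := hNtop.eventually (eventually_ge_atTop 1)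
  have hevM : ∀ᶠ δ in 𝓝[>] (0 : ℝ), 1 ≤ M δ := hMtop.eventually (eventually_ge_atTop 1)
  refine hlim.congr' ?_
  filter_upwards [hevN, hevM, self_mem_nhdsWithin] with δ hNδ hMδ hδ
  have hδ0 : (0 : ℝ) < δ := hδ
  have hN0 : (0 : ℝ) < ((N δ : ℕ) : ℝ) := by exact_mod_cast hNδ
  have hM0 : (0 : ℝ) < ((M δ : ℕ) : ℝ) := by exact_mod_cast hMδ
  have e1 : ⌊δ⁻¹⌋ = ((N δ : ℕ) : ℤ) := (Int.natCast_floor_eq_floor (inv_nonneg.2 hδ0.le)).symm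
  have e2 : ⌊(c * δ)⁻¹⌋ = ((M δ : ℕ) : ℤ) :=
    (Int.natCast_floor_eq_floor (inv_nonneg.2 (mul_pos hc hδ0).le)).symm
  rw [e1, e2]
  have hinner : (g (N δ) * ((N δ : ℕ) : ℝ) ^ (2 * Δ)) / (g (M δ) * ((M δ : ℕ) : ℝ) ^ (2 * Δ)) *
      (((M δ : ℕ) : ℝ) / ((N δ : ℕ) : ℝ)) ^ (2 * Δ) = g (N δ) / g (M δ) := by
    rw [Real.div_rpow hM0.le hN0.le]
    have hgM : g (M δ) ≠ 0 := (gpos _).ne'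
    have hNp : ((N δ : ℕ) : ℝ) ^ (2 * Δ) ≠ 0 := (Real.rpow_pos_of_pos hN0 _).ne'
    have hMp : ((M δ : ℕ) : ℝ) ^ (2 * Δ) ≠ 0 := (Real.rpow_pos_of_pos hM0 _).ne'
    field_simp
  rw [hinner, Real.sqrt_div' _ (gpos _).le, one_div, one_div, inv_div_inv]

/-! ### The lossless iff: r2 ⟺ T1 ∧ 5047 ∧ 6036 -/

/-- **The crux is EQUIVALENT to T1 ∧ item 5047 ∧ item 6036 (registered name, verbatim).**
⇒: `towerLaw_of_rotInvPowerLaw` (r2 ⇒ T1), `twoPointRegularVariation_of_rotInvPowerLaw` (r2 ⇒ 5047)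
and `twoPointAsymptoticIsotropy_of_rotInvPowerLaw` (r2 ⇒ 6036, route HarmonicMomentsIsotropy);
⇐: the Karamata link `integerDilationLaw_of_twoPointRegularVariation` (5047 ⇒ S2) and the glue
`IsingEuclidUpgradeR2RotInvPowerLaw_of_towerLaw_of_dilationLaw_of_vague` (T1 → S2 → 6036 → r2).
[cite: DuminilCopinICM2022, §8.1] -/
theorem rotInvPowerLaw_iff_towerLaw_and_twoPointRegularVariation_and_vague : Summit.CriticalPhenomena.Ising3DConformalLimit.Theses.IsingEuclidUpgrade.IsingEuclidUpgradeR2RotInvPowerLaw ↔ ((∃ Δ c : ℝ, 0 < c ∧ Filter.Tendsto (fun j : ℕ => Literature.Probability.LatticeModels.criticalTwoPoint 3 (Pi.single 0 ((2 ^ j : ℕ) : ℤ)) * ((2 ^ j : ℕ) : ℝ) ^ (2 * Δ)) Filter.atTop (nhds c)) ∧ Summit.CriticalPhenomena.Ising3DConformalLimit.Theses.BallOrbitComparison.TwoPointRegularVariation ∧ Summit.CriticalPhenomena.Ising3DConformalLimit.Theses.HarmonicMomentsIsotropy.TwoPointAsymptoticIsotropy) :=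
  ⟨fun h => ⟨towerLaw_of_rotInvPowerLaw h, twoPointRegularVariation_of_rotInvPowerLaw h,
      twoPointAsymptoticIsotropy_of_rotInvPowerLaw h⟩,
    fun h => IsingEuclidUpgradeR2RotInvPowerLaw_of_towerLaw_of_dilationLaw_of_vague h.1
      (integerDilationLaw_of_twoPointRegularVariation h.2.1) h.2.2⟩

end Summit.CriticalPhenomena.Ising3DConformalLimit.Cruxes.IsingEuclidUpgradeR2RotInvPowerLaw.TowerProfileRigidity

end
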